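import Literature.MathematicalPhysics.QuantumFieldTheory.Balaban1983to89.B15Layer199Lattice
import Literature.MathematicalPhysics.QuantumFieldTheory.Balaban1983to89.B14ArgField36Lattice
import Literature.MathematicalPhysics.QuantumFieldTheory.Balaban1983to89.B15Ineq184Local

/-!
# `Balaban1983to89.B15LayerLocal` — the argument fields of the standard representations ([IV] (1.30), (1.56), (1.90),
# p. 199; [III] (3.6), (3.17)) on the `ℤ^d` carriers, LOCAL CARRIER: the regularity inputs assumed on the plaquettes of
# the finest cube of the tower ONLY (print's *"on this domain"*, *"for p ⊂ □^∼"*, *"for p ∈ Ω_k"*), for the three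
# companion files `B15Layer130Lattice`, `B14ArgField36Lattice`, `B15Layer199Lattice`

statement-level skeleton of published theorems with citation tags; proofs where landed; nothing here is a claim about the Yang–Mills mass gap

CITATION HEADER (lean-in-tree rule 2026-08-18).  T. Bałaban, *Large field renormalization. I. The basic step of the 𝐑
operation*, Commun. Math. Phys. **122** (1989) 175–202, doi:10.1007/BF01257412, bib `Balaban1989LargeFieldI` ("[IV]",
cell paper B15; PDF held `paper:balaban1989-cmp122-large-field-i`, journal page = PDF page + 174); T. Bałaban,
*Convergent renormalization expansions for lattice gauge theories*, Commun. Math. Phys. **119** (1988) 243–285,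
doi:10.1007/BF01217741, bib `Balaban1988Convergent` ("[III]", cell paper B14; `paper:balaban1988-cmp119-convergent-
renormalization`, journal page = PDF page + 242); their common references [14] = `Balaban1985RegularSpaces` ((1.65)
p. 87, (1.7) p. 77 *"|U(∂p) − 1| < α₀L^{−2j} for p ∈ Ω_j"*), [12] = `Balaban1985Averaging` ((26), (43)).  Pages READ AS
IMAGES on the x2 renders under `run/shared/lean/pub/pub-balaban/b2b-balaban-ref1/pages/` (p. 183–184, 188, 198–199 of
[IV]; p. 266, 268 of [III]).  The papers are manuscripts under adjudication by the audit cell `pub-balaban`; nothing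
printed in them is used as a fact here.

WHAT IS REPRODUCED (mega-formalization `lit-balaban`, HOME `run/shared/lean/pub/lit-balaban/`, Phase-2 proof seat p29,
generation 7; SKELETON rows **B15.Eq1.30**, **B15.Eq1.56**, **B15.Eq1.90**, **B15.Eq1.97** (reader/fold owner r12,
referee ref-5) and **B14.Claim@265** ((3.6)), **B14.Eq3.16–3.19** ((3.17)) (reader/fold owner r11)).  The companion
files of this seat prove the located sizes of the argument fields `(1/i)log[M˙(U)(M˙(Q^{s*}V))⁻¹]` (pull-back
background: `B15Layer130Lattice` p263483, `B14ArgField36Lattice` p264453) and `(1/i)log[M˙(U″_{k,Z})(M˙(U₀^{(AL)}))⁻¹]`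
(two fine fields: `B15Layer199Lattice` p265340) with the regularity of the fine field(s) in the GLOBAL sup form
`pdev U < αξ²` on all of `ℤ^d` (their HONEST SCOPE (1)).  Print states these inputs on DOMAINS: [IV] p. 183 *"On this
domain the configuration U_k^{(n)} satisfies the last inequality in (1.24)"*, (1.96) *"for p ⊂ □^∼"*, (1.80) *"for p ∈
Ω_k"*, [III] p. 268 *"on Ω_{k+1}"*, [14] (1.7) *"for p ∈ Ω_j"*.  THIS FILE gives every theorem of the three companions in
the LOCAL form: the plaquette bound is assumed on the unit plaquettes of the finest cube `[tlo L lo K, thi L hi K]` of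
the tower only (`B7Prop1Local.pdevOn`), with the same conclusions on the tower of cubes.

THE PROOF — the tree's localisation device, BY NAME (p26's `B8Ineq165Local` / `B15Ineq184Local`, themselves after
`B8Ineq130.ineq130_local`): the clamped extension `π*U = clampCfg (tlo K) (thi K) U` (`B7Prop1Local.clampCfg`) is
`G`-valued (`clampCfg_mem`), satisfies the plaquette bound EVERYWHERE (`pdev_clampCfg_le`: every plaquette variable of
`π*U` is `1` or one of `U` inside the cube), and its averages agree with those of `U` on the whole tower of cubes
(`B8Ineq130.agree_level`, the printed locality of (43) [12], from `clampCfg_agree`); this transfers the block-axial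
gauge (1.15)/(1.19) of [14] (`axialFn_congr`), the top constraint / top closeness, the pull-backs of the top field
(`B15Ineq184Local.pullIter_congr`) and the conclusions, so the GLOBAL theorems applied to `π*U` (and `π*U₀`) yield
the local ones for `U` (and `U₀`); for the orbit forms the gauge is `towerGauge L (π*U) K lo`, resp. `twGauge L (π*U₀)
(π*U) K y`, which is a gauge for `U` itself on the tower (`gaugeAct_agree`, cf. `B15Ineq184Local.gauge_inside`).

CONTENTS.  `§1` (pull-back background) `norm_argField_le_local`, `argField_lt_local`, `argField_lt_orbit_local`, and the
printed-constant instances `layer130_lt_local` ([IV] (1.30): 22d²ε_j), `layer156_lt_local` ((1.56): 44d²B₃ε_k),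
`layer317_lt_local` ([III] (3.17): 44d²B₃ε_{k+1}), `layer190_lt_local` ((1.90): 11d²ε_h), `argField36_lt_local` ([III]
(3.6): 4δ_k + 22d²α);  `§2` (two fine fields) `norm_argField2_le_local`, `norm_argField2_le_orbit_local`,
`layer199_lt_max_local`, `layer199_lt_local` ([IV] p. 199: `22d²max{1,X}ε_h + 2δ′_k`, `< 23d²ε_h`).

HONEST SCOPE / DEVIATIONS.  Exactly as in the three companion files (tower of cubes ⊇ the printed layers, `M˙`
componentwise, `AvgClosed` value group `G ≤ U1 𝔸`, smallness explicit, top hypotheses as located there), EXCEPT that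
their deviation (1) — global instead of local regularity — is removed: only the plaquettes of the finest cube enter.
The exponential tails of (1.80) outside `Λ` and the precise shapes of the printed domains (`□^∼`, `Ω_{k+1}`,
`(Ω″^∼_{h+1})^c∩Ω_h`) are not modelled: the finest cube of the tower stands for them.  Every declaration is a proved
theorem; no `def`, no new `Prop` fact; standard axioms.  Unit `lit-balaban-p29` (literature-prover-lit-balaban-p29-g7-0).
-/

noncomputable section

open scoped BigOperators
open NormedSpace Finset

namespace Literature.MathematicalPhysics.QuantumFieldTheory.Balaban1983to89.B15LayerLocal

open MatrixLog B7Prop1Explicit B7Prop2Explicit B7Prop1Local B8Lemma1NonAbelian B8Ineq129 B8Ineq130 B8Ineq165Descent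
  B15Ineq184BlockAxial B15Ineq184Local B7AvgGaugeCovariance B8Eq115GaugeFixing B8Eq119TwistedAxial B15Layer130Lattice
  B14ArgField36Lattice B15Layer199Lattice

-- `Site` alone would resolve to the torus sites of `Setup.lean`; re-export the `ℤ^d` sites of `B7Prop1Explicit`.
export B7Prop1Explicit (Site)

variable {d : ℕ}

/-! ## §0 The localisation device: averages of the clamped extension agree on the tower -/

section Device

variable {𝔸 : Type*} [NormedRing 𝔸] [NormOneClass 𝔸] [NormedAlgebra ℂ 𝔸] [CompleteSpace 𝔸]

omit [NormOneClass 𝔸] in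
/-- The averages of `π*U` (clamped at the finest cube of a tower of `K` levels) and of `U` agree bondwise on the depth-`m`
cube, `m + j = K` — `B8Ineq130.agree_level` ∘ `clampCfg_agree`, the locality of (43) [12].
[cite: Balaban1985Averaging, (43) p.24] -/
theorem avgIter_clamp_eq {L : ℕ} (hL : 1 ≤ L) {lo hi : Site d} {K : ℕ} (U : Site d → Fin d → 𝔸ˣ) (u : Site d → 𝔸ˣ)
    {j m : ℕ} (hmj : m + j = K) {x : Site d} {ν : Fin d} (hx : tlo L lo m ≤ x) (hxν : x + e ν ≤ thi L hi m) :
    avgIter L (gaugeAct u (clampCfg (tlo L lo K) (thi L hi K) U)) j x ν = avgIter L (gaugeAct u U) j x ν :=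
  agree_level hL j m (by rw [hmj]; exact gaugeAct_agree (clampCfg_agree U) u) x ν
    (inBox_of_le hx (le_of_add_e_le hxν)) (inBox_of_le (hx.trans (le_add_of_nonneg_right (e_nonneg ν))) hxν)

omit [NormOneClass 𝔸] in
/-- The same without a gauge transformation (`u = 1`). [cite: Balaban1985Averaging, (43) p.24] -/
theorem avgIter_clamp_eq' {L : ℕ} (hL : 1 ≤ L) {lo hi : Site d} {K : ℕ} (U : Site d → Fin d → 𝔸ˣ)
    {j m : ℕ} (hmj : m + j = K) {x : Site d} {ν : Fin d} (hx : tlo L lo m ≤ x) (hxν : x + e ν ≤ thi L hi m) :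
    avgIter L (clampCfg (tlo L lo K) (thi L hi K) U) j x ν = avgIter L U j x ν :=
  agree_level hL j m (by rw [hmj]; exact clampCfg_agree U) x ν
    (inBox_of_le hx (le_of_add_e_le hxν)) (inBox_of_le (hx.trans (le_add_of_nonneg_right (e_nonneg ν))) hxν)

omit [NormOneClass 𝔸] in
/-- Transport along the block contours `Γ_{Lz, Lz+r}` of the tower agrees for `(π*U)^u` and `U^u`.
[cite: Balaban1985RegularSpaces, (1.15) p.78, (1.19) p.79] -/
theorem axialFn_clamp_eq {L : ℕ} (hL : 1 ≤ L) {lo hi : Site d} {K : ℕ} (U : Site d → Fin d → 𝔸ˣ) (u : Site d → 𝔸ˣ)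
    {n : ℕ} (hn : n < K) {z : Site d} (hz : tlo L lo n ≤ z) (hz' : z ≤ thi L hi n) (r : Fin d → Fin L) :
    axialFn (avgIter L (gaugeAct u (clampCfg (tlo L lo K) (thi L hi K) U)) (K - (n + 1))) ((L : ℤ) • z)
        ((L : ℤ) • z + boxVec L r) =
      axialFn (avgIter L (gaugeAct u U) (K - (n + 1))) ((L : ℤ) • z) ((L : ℤ) • z + boxVec L r) := by
  obtain ⟨h1, h2⟩ := block_mem hz hz' r
  obtain ⟨h3, h4⟩ := smul_mem hL hz hz'
  exact axialFn_congr (agree_level hL (K - (n + 1)) (n + 1)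
    (by rw [show n + 1 + (K - (n + 1)) = K by omega]; exact gaugeAct_agree (clampCfg_agree U) u)) _ _
    (inBox_of_le h3 h4) (inBox_of_le h1 h2)

omit [NormOneClass 𝔸] in
/-- The same without a gauge transformation. [cite: Balaban1985RegularSpaces, (1.15) p.78] -/
theorem axialFn_clamp_eq' {L : ℕ} (hL : 1 ≤ L) {lo hi : Site d} {K : ℕ} (U : Site d → Fin d → 𝔸ˣ)
    {n : ℕ} (hn : n < K) {z : Site d} (hz : tlo L lo n ≤ z) (hz' : z ≤ thi L hi n) (r : Fin d → Fin L) :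
    axialFn (avgIter L (clampCfg (tlo L lo K) (thi L hi K) U) (K - (n + 1))) ((L : ℤ) • z)
        ((L : ℤ) • z + boxVec L r) =
      axialFn (avgIter L U (K - (n + 1))) ((L : ℤ) • z) ((L : ℤ) • z + boxVec L r) := by
  have h := axialFn_clamp_eq hL U (1 : Site d → 𝔸ˣ) hn hz hz' r
  simpa only [gaugeAct_one] using h

omit [NormedAlgebra ℂ 𝔸] [CompleteSpace 𝔸] in
/-- The clamped extension of a `G`-valued, locally regular field is `G`-valued and globally regular.
[cite: Balaban1985RegularSpaces, (1.7) p.77] -/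
theorem clamp_regular {L : ℕ} (hL : 1 ≤ L) {G : Subgroup 𝔸ˣ} (hG1 : G ≤ U1 𝔸) {lo hi : Site d} (hlohi : lo ≤ hi)
    {K : ℕ} {U : Site d → Fin d → 𝔸ˣ} (hU : ∀ x κ, U x κ ∈ G) {a : ℝ}
    (h : pdevOn (tlo L lo K) (thi L hi K) U < a) :
    (∀ x κ, clampCfg (tlo L lo K) (thi L hi K) U x κ ∈ G) ∧ pdev (clampCfg (tlo L lo K) (thi L hi K) U) < a :=
  ⟨clampCfg_mem hU, (pdev_clampCfg_le (tlo_le_thi hL hlohi K) fun x κ => hG1 (hU x κ)).trans_lt h⟩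

end Device

/-! ## §1 Pull-back background ((1.30)/(1.56)/(1.90) [IV], (3.6)/(3.17) [III]), regularity on the finest cube only -/

section PullBack

variable {𝔸 : Type*} [NormedRing 𝔸] [NormOneClass 𝔸] [NormedAlgebra ℂ 𝔸] [CompleteSpace 𝔸]

/-- **`B15Layer130Lattice.norm_argField_le`, LOCAL CARRIER**: the same hypotheses except that the plaquette bound
`|U(∂p) − 1| < αξ²` is assumed on the unit plaquettes of the finest cube `[tlo k, thi k]` only; same conclusion
`|(1/i)log[M^{k−n}(U)(b)((Q^{s*}_nV)(b))⁻¹]| ≤ 2(α₁ + 8d²αΣ) < 2α₁ + 22d²α` on the bonds of the depth-`n` cube (both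
orders). [cite: Balaban1989LargeFieldI, p.183–184 (after (1.30)); Balaban1985RegularSpaces, (1.7) p.77, (1.65) p.87] -/
theorem norm_argField_le_local (L : ℕ) (hL : 2 ≤ L) (hd : 1 ≤ d) {G : Subgroup 𝔸ˣ} (hG : AvgClosed d L G)
    (k : ℕ) (U : Site d → Fin d → 𝔸ˣ) (hU : ∀ x κ, U x κ ∈ G) {α : ℝ} (hα : 0 < α) (hα3 : C0 d * α ≤ 1 / 3)
    (hα2 : 2 * α ≤ c2' d L) (lo hi : Site d) (hlohi : lo ≤ hi)
    (h17 : pdevOn (tlo L lo k) (thi L hi k) U < α * (((L : ℝ) ^ k)⁻¹) ^ 2)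
    (V : Site d → Fin d → 𝔸ˣ) (hV : ∀ x μ, V x μ ∈ U1 𝔸) {α₁ : ℝ} (hα₁ : 0 ≤ α₁)
    (hs : α₁ + 11 * (d : ℝ) ^ 2 * α ≤ 1 / 6)
    (h15 : ∀ n, n < k → ∀ z, tlo L lo n ≤ z → z ≤ thi L hi n → ∀ r : Fin d → Fin L,
      axialFn (avgIter L U (k - (n + 1))) ((L : ℤ) • z) ((L : ℤ) • z + boxVec L r) = 1)
    (htop : ∀ x ν, lo ≤ x → x + e ν ≤ hi → ‖((avgIter L U k x ν : 𝔸ˣ) : 𝔸) - V x ν‖ ≤ α₁)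
    (n : ℕ) (hn : n ≤ k) (x : Site d) (ν : Fin d) (hx : tlo L lo n ≤ x) (hxν : x + e ν ≤ thi L hi n) :
    ‖mlog (((avgIter L U (k - n) x ν * (pullIter L V n x ν)⁻¹ : 𝔸ˣ) : 𝔸))‖ ≤
        2 * (α₁ + 8 * (d : ℝ) ^ 2 * α * ∑ m ∈ Finset.range n, (((L : ℝ) ^ m)⁻¹) ^ 2) ∧
      ‖mlog (((pullIter L V n x ν * (avgIter L U (k - n) x ν)⁻¹ : 𝔸ˣ) : 𝔸))‖ ≤
        2 * (α₁ + 8 * (d : ℝ) ^ 2 * α * ∑ m ∈ Finset.range n, (((L : ℝ) ^ m)⁻¹) ^ 2) ∧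
      2 * (α₁ + 8 * (d : ℝ) ^ 2 * α * ∑ m ∈ Finset.range n, (((L : ℝ) ^ m)⁻¹) ^ 2) <
        2 * α₁ + 22 * (d : ℝ) ^ 2 * α := by
  have hL1 : 1 ≤ L := le_trans (by norm_num) hL
  obtain ⟨hW, h17'⟩ := clamp_regular hL1 hG.le_U1 hlohi hU h17
  have htop' : ∀ x ν, lo ≤ x → x + e ν ≤ hi →
      ‖((avgIter L (clampCfg (tlo L lo k) (thi L hi k) U) k x ν : 𝔸ˣ) : 𝔸) - V x ν‖ ≤ α₁ := fun x ν hx hxν => by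
    rw [avgIter_clamp_eq' hL1 U (j := k) (m := 0) (by simp) (by simpa using hx) (by simpa using hxν)]
    exact htop x ν hx hxν
  have h := norm_argField_le L hL hd hG k _ hW hα hα3 hα2 h17' V hV hα₁ hs lo hi
    (fun n hn z hz hz' r => by rw [axialFn_clamp_eq' hL1 U hn hz hz' r]; exact h15 n hn z hz hz' r) htop' n hn x ν hx hxν
  rwa [avgIter_clamp_eq' hL1 U (show n + (k - n) = k by omega) hx hxν] at h

/-- **`B15Layer130Lattice.argField_lt`, LOCAL CARRIER** (*"by the argument leading to (1.65) in [14]"*, generic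
constant): `|U(∂p) − 1| < αξ²` on the plaquettes of the finest cube only, `U` block-axial on the tower, top field
`V = M^k(U)`: `|(1/i)log[M^{k−n}(U)(b)((Q^{s*}_nM^k(U))(b))⁻¹]| < 22d²α` on the bonds of the depth-`n` cube (both
orders). [cite: Balaban1989LargeFieldI, p.184 l.1 ((1.65) in [14]); Balaban1985RegularSpaces, (1.7) p.77] -/
theorem argField_lt_local (L : ℕ) (hL : 2 ≤ L) (hd : 1 ≤ d) {G : Subgroup 𝔸ˣ} (hG : AvgClosed d L G)
    (k : ℕ) (U : Site d → Fin d → 𝔸ˣ) (hU : ∀ x κ, U x κ ∈ G) {α : ℝ} (hα : 0 < α) (hα3 : C0 d * α ≤ 1 / 3)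
    (hα2 : 2 * α ≤ c2' d L) (hαs : 11 * (d : ℝ) ^ 2 * α ≤ 1 / 6) (lo hi : Site d) (hlohi : lo ≤ hi)
    (h17 : pdevOn (tlo L lo k) (thi L hi k) U < α * (((L : ℝ) ^ k)⁻¹) ^ 2)
    (h15 : ∀ n, n < k → ∀ z, tlo L lo n ≤ z → z ≤ thi L hi n → ∀ r : Fin d → Fin L,
      axialFn (avgIter L U (k - (n + 1))) ((L : ℤ) • z) ((L : ℤ) • z + boxVec L r) = 1)
    (n : ℕ) (hn : n ≤ k) (x : Site d) (ν : Fin d) (hx : tlo L lo n ≤ x) (hxν : x + e ν ≤ thi L hi n) :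
    ‖mlog (((avgIter L U (k - n) x ν * (pullIter L (avgIter L U k) n x ν)⁻¹ : 𝔸ˣ) : 𝔸))‖ <
        22 * (d : ℝ) ^ 2 * α ∧
      ‖mlog (((pullIter L (avgIter L U k) n x ν * (avgIter L U (k - n) x ν)⁻¹ : 𝔸ˣ) : 𝔸))‖ <
        22 * (d : ℝ) ^ 2 * α := by
  have hL1 : 1 ≤ L := le_trans (by norm_num) hL
  obtain ⟨hW, h17'⟩ := clamp_regular hL1 hG.le_U1 hlohi hU h17
  have htop : ∀ x ν, lo ≤ x → x + e ν ≤ hi →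
      avgIter L (clampCfg (tlo L lo k) (thi L hi k) U) k x ν = avgIter L U k x ν := fun x ν hx hxν =>
    avgIter_clamp_eq' hL1 U (j := k) (m := 0) (by simp) (by simpa using hx) (by simpa using hxν)
  have h := argField_lt L hL hd hG k _ hW hα hα3 hα2 hαs h17' lo hi
    (fun n hn z hz hz' r => by rw [axialFn_clamp_eq' hL1 U hn hz hz' r]; exact h15 n hn z hz hz' r) n hn x ν hx hxν
  rwa [avgIter_clamp_eq' hL1 U (show n + (k - n) = k by omega) hx hxν, pullIter_congr hL1 htop n x ν hx hxν] at h

/-- **`B15Layer130Lattice.argField_lt_orbit`, LOCAL CARRIER**: for EVERY `G`-valued `U` with `|U(∂p) − 1| < αξ²` on the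
plaquettes of the finest cube only, the gauge `u = towerGauge L (π*U) k lo` of the clamped extension puts `U` ITSELF
in the axial gauge in blocks on the tower (cf. `B15Ineq184Local.gauge_inside`), and the representative `U^u` satisfies
`< 22d²α` at every depth and bond (both orders). [cite: Balaban1989LargeFieldI, p.184 l.1, p.197 ("axial gauge in k-blocks"); Balaban1985RegularSpaces, (1.7) p.77, p.78] -/
theorem argField_lt_orbit_local (L : ℕ) (hL : 2 ≤ L) (hd : 1 ≤ d) {G : Subgroup 𝔸ˣ} (hG : AvgClosed d L G)
    (k : ℕ) (U : Site d → Fin d → 𝔸ˣ) (hU : ∀ x κ, U x κ ∈ G) {α : ℝ} (hα : 0 < α) (hα3 : C0 d * α ≤ 1 / 3)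
    (hα2 : 2 * α ≤ c2' d L) (hαs : 11 * (d : ℝ) ^ 2 * α ≤ 1 / 6) (lo hi : Site d) (hlohi : lo ≤ hi)
    (h17 : pdevOn (tlo L lo k) (thi L hi k) U < α * (((L : ℝ) ^ k)⁻¹) ^ 2)
    (n : ℕ) (hn : n ≤ k) (x : Site d) (ν : Fin d) (hx : tlo L lo n ≤ x) (hxν : x + e ν ≤ thi L hi n) :
    ‖mlog (((avgIter L (gaugeAct (towerGauge L (clampCfg (tlo L lo k) (thi L hi k) U) k lo) U) (k - n) x ν *
        (pullIter L (avgIter L (gaugeAct (towerGauge L (clampCfg (tlo L lo k) (thi L hi k) U) k lo) U) k)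
          n x ν)⁻¹ : 𝔸ˣ) : 𝔸))‖ < 22 * (d : ℝ) ^ 2 * α ∧
      ‖mlog (((pullIter L (avgIter L (gaugeAct (towerGauge L (clampCfg (tlo L lo k) (thi L hi k) U) k lo) U) k)
          n x ν *
        (avgIter L (gaugeAct (towerGauge L (clampCfg (tlo L lo k) (thi L hi k) U) k lo) U) (k - n) x ν)⁻¹ :
          𝔸ˣ) : 𝔸))‖ < 22 * (d : ℝ) ^ 2 * α := by
  have hL1 : 1 ≤ L := le_trans (by norm_num) hL
  obtain ⟨hW, h17'⟩ := clamp_regular hL1 hG.le_U1 hlohi hU h17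
  set W := clampCfg (tlo L lo k) (thi L hi k) U with hWdef
  set u := towerGauge L W k lo with hu
  have htop : ∀ x ν, lo ≤ x → x + e ν ≤ hi →
      avgIter L (gaugeAct u W) k x ν = avgIter L (gaugeAct u U) k x ν := fun x ν hx hxν =>
    avgIter_clamp_eq hL1 U u (j := k) (m := 0) (by simp) (by simpa using hx) (by simpa using hxν)
  have h := argField_lt_orbit L hL hd hG k W hW hα hα3 hα2 hαs h17' lo hi n hn x ν hx hxν
  rwa [avgIter_clamp_eq hL1 U u (show n + (k - n) = k by omega) hx hxν, pullIter_congr hL1 htop n x ν hx hxν] at h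

/-- **[IV] (1.30) p. 183–184, printed constant `22d²ε_j`, LOCAL CARRIER** — the last inequality of (1.24) (c = 1),
*"On this domain … |U_k^{(n)}(∂p) − 1| < (1 − β½)ε_j(L^{k−j}η)²"*, assumed on the plaquettes of the finest cube only.
[cite: Balaban1989LargeFieldI, p.183–184 (after (1.30))] -/
theorem layer130_lt_local (L : ℕ) (hL : 2 ≤ L) (hd : 1 ≤ d) {G : Subgroup 𝔸ˣ} (hG : AvgClosed d L G)
    (j : ℕ) (U : Site d → Fin d → 𝔸ˣ) (hU : ∀ x κ, U x κ ∈ G) {β εj : ℝ} (hβ : 0 ≤ β) (hε : 0 < εj)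
    (hε3 : C0 d * εj ≤ 1 / 3) (hε2 : 2 * εj ≤ c2' d L) (hεs : 11 * (d : ℝ) ^ 2 * εj ≤ 1 / 6)
    (lo hi : Site d) (hlohi : lo ≤ hi)
    (h124 : pdevOn (tlo L lo j) (thi L hi j) U < (1 - β * (1 / 2)) * εj * (((L : ℝ) ^ j)⁻¹) ^ 2)
    (h15 : ∀ n, n < j → ∀ z, tlo L lo n ≤ z → z ≤ thi L hi n → ∀ r : Fin d → Fin L,
      axialFn (avgIter L U (j - (n + 1))) ((L : ℤ) • z) ((L : ℤ) • z + boxVec L r) = 1)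
    (n : ℕ) (hn : n ≤ j) (x : Site d) (ν : Fin d) (hx : tlo L lo n ≤ x) (hxν : x + e ν ≤ thi L hi n) :
    ‖mlog (((avgIter L U (j - n) x ν * (pullIter L (avgIter L U j) n x ν)⁻¹ : 𝔸ˣ) : 𝔸))‖ <
      22 * (d : ℝ) ^ 2 * εj := by
  have hq : 0 ≤ (((L : ℝ) ^ j)⁻¹) ^ 2 := by positivity
  have h17 : pdevOn (tlo L lo j) (thi L hi j) U < εj * (((L : ℝ) ^ j)⁻¹) ^ 2 := by
    refine h124.trans_le (mul_le_mul_of_nonneg_right ?_ hq)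
    nlinarith
  exact (argField_lt_local L hL hd hG j U hU hε hε3 hε2 hεs lo hi hlohi h17 h15 n hn x ν hx hxν).1

/-- **[IV] (1.56) p. 188, printed constant `44d²B₃ε_k`, LOCAL CARRIER** — the plaquette bound `2B₃ε_kη²` of the fine
field assumed on the plaquettes of the finest cube only. [cite: Balaban1989LargeFieldI, p.188 (after (1.56))] -/
theorem layer156_lt_local (L : ℕ) (hL : 2 ≤ L) (hd : 1 ≤ d) {G : Subgroup 𝔸ˣ} (hG : AvgClosed d L G)
    (k : ℕ) (U : Site d → Fin d → 𝔸ˣ) (hU : ∀ x κ, U x κ ∈ G) {B₃ εk : ℝ} (hB₃ : 0 < B₃) (hε : 0 < εk)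
    (hs3 : C0 d * (2 * B₃ * εk) ≤ 1 / 3) (hs2 : 2 * (2 * B₃ * εk) ≤ c2' d L)
    (hs : 11 * (d : ℝ) ^ 2 * (2 * B₃ * εk) ≤ 1 / 6) (lo hi : Site d) (hlohi : lo ≤ hi)
    (h : pdevOn (tlo L lo k) (thi L hi k) U < 2 * B₃ * εk * (((L : ℝ) ^ k)⁻¹) ^ 2)
    (h15 : ∀ n, n < k → ∀ z, tlo L lo n ≤ z → z ≤ thi L hi n → ∀ r : Fin d → Fin L,
      axialFn (avgIter L U (k - (n + 1))) ((L : ℤ) • z) ((L : ℤ) • z + boxVec L r) = 1)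
    (n : ℕ) (hn : n ≤ k) (x : Site d) (ν : Fin d) (hx : tlo L lo n ≤ x) (hxν : x + e ν ≤ thi L hi n) :
    ‖mlog (((avgIter L U (k - n) x ν * (pullIter L (avgIter L U k) n x ν)⁻¹ : 𝔸ˣ) : 𝔸))‖ <
      44 * (d : ℝ) ^ 2 * B₃ * εk := by
  have h1 := (argField_lt_local L hL hd hG k U hU (by positivity) hs3 hs2 hs lo hi hlohi h h15 n hn x ν hx hxν).1
  linarith

/-- **[III] (3.17) p. 268, printed constant `44d²B₃ε_{k+1}`, LOCAL CARRIER** — *"The field U_{k+1} satisfies the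
regularity condition |∂U_{k+1} − 1| < 2B₃ε_{k+1}(L⁻¹η)² on Ω_{k+1}, hence the argument of the function 𝐇_{k+1,□′} is
bounded by 44d²B₃ε_{k+1}"* with the regularity assumed on the plaquettes of the finest cube only (print: *"on
Ω_{k+1}"*). [cite: Balaban1988Convergent, p.268 (after (3.17))] -/
theorem layer317_lt_local (L : ℕ) (hL : 2 ≤ L) (hd : 1 ≤ d) {G : Subgroup 𝔸ˣ} (hG : AvgClosed d L G)
    (K : ℕ) (U : Site d → Fin d → 𝔸ˣ) (hU : ∀ x κ, U x κ ∈ G) {B₃ εk1 : ℝ} (hB₃ : 0 < B₃) (hε : 0 < εk1)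
    (hs3 : C0 d * (2 * B₃ * εk1) ≤ 1 / 3) (hs2 : 2 * (2 * B₃ * εk1) ≤ c2' d L)
    (hs : 11 * (d : ℝ) ^ 2 * (2 * B₃ * εk1) ≤ 1 / 6) (lo hi : Site d) (hlohi : lo ≤ hi)
    (h : pdevOn (tlo L lo K) (thi L hi K) U < 2 * B₃ * εk1 * (((L : ℝ) ^ K)⁻¹) ^ 2)
    (h15 : ∀ n, n < K → ∀ z, tlo L lo n ≤ z → z ≤ thi L hi n → ∀ r : Fin d → Fin L,
      axialFn (avgIter L U (K - (n + 1))) ((L : ℤ) • z) ((L : ℤ) • z + boxVec L r) = 1)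
    (n : ℕ) (hn : n ≤ K) (x : Site d) (ν : Fin d) (hx : tlo L lo n ≤ x) (hxν : x + e ν ≤ thi L hi n) :
    ‖mlog (((avgIter L U (K - n) x ν * (pullIter L (avgIter L U K) n x ν)⁻¹ : 𝔸ˣ) : 𝔸))‖ <
      44 * (d : ℝ) ^ 2 * B₃ * εk1 := by
  have h1 := (argField_lt_local L hL hd hG K U hU (by positivity) hs3 hs2 hs lo hi hlohi h h15 n hn x ν hx hxν).1
  linarith

/-- **[IV] (1.90) p. 198, B-size `11d²ε_h`, LOCAL CARRIER** — the plaquette bound `½ε_hξ²` (`ξ = L^{k−h}η = L^{−h}`, a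
tower of `K = h` levels below `T^{(h)}`) assumed on the plaquettes of the finest cube only (print: the cube `□^∼`).
[cite: Balaban1989LargeFieldI, p.198 (after (1.90))] -/
theorem layer190_lt_local (L : ℕ) (hL : 2 ≤ L) (hd : 1 ≤ d) {G : Subgroup 𝔸ˣ} (hG : AvgClosed d L G)
    (K : ℕ) (U : Site d → Fin d → 𝔸ˣ) (hU : ∀ x κ, U x κ ∈ G) {εh : ℝ} (hε : 0 < εh)
    (hs3 : C0 d * (εh * (1 / 2)) ≤ 1 / 3) (hs2 : 2 * (εh * (1 / 2)) ≤ c2' d L)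
    (hs : 11 * (d : ℝ) ^ 2 * (εh * (1 / 2)) ≤ 1 / 6) (lo hi : Site d) (hlohi : lo ≤ hi)
    (h : pdevOn (tlo L lo K) (thi L hi K) U < εh * (1 / 2) * (((L : ℝ) ^ K)⁻¹) ^ 2)
    (h15 : ∀ n, n < K → ∀ z, tlo L lo n ≤ z → z ≤ thi L hi n → ∀ r : Fin d → Fin L,
      axialFn (avgIter L U (K - (n + 1))) ((L : ℤ) • z) ((L : ℤ) • z + boxVec L r) = 1)
    (n : ℕ) (hn : n ≤ K) (x : Site d) (ν : Fin d) (hx : tlo L lo n ≤ x) (hxν : x + e ν ≤ thi L hi n) :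
    ‖mlog (((avgIter L U (K - n) x ν * (pullIter L (avgIter L U K) n x ν)⁻¹ : 𝔸ˣ) : 𝔸))‖ <
      11 * (d : ℝ) ^ 2 * εh := by
  have h1 := (argField_lt_local L hL hd hG K U hU (by positivity) hs3 hs2 hs lo hi hlohi h h15 n hn x ν hx hxν).1
  linarith

/-- **[III] (3.6) p. 266 (`B14ArgField36Lattice.argField36_lt`), LOCAL CARRIER** — (3.2) `|U(∂p) − 1| <
ε_{k+1}(L⁻¹η)²`-type regularity `< αξ²` assumed on the plaquettes of the finest cube only, (3.3) `|V(b)(M^k(U)(b))⁻¹ − 1| <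
2δ_k` on the top cube, `U` block-axial on the tower: `|(1/i)log[(Q^{s*}_nV)(b)(M^{k−n}(U)(b))⁻¹]| ≤ 2(2δ_k + 8d²αΣ) <
4δ_k + 22d²α`. [cite: Balaban1988Convergent, p.266 (after (3.6)), (3.2)-(3.3) p.265] -/
theorem argField36_lt_local (L : ℕ) (hL : 2 ≤ L) (hd : 1 ≤ d) {G : Subgroup 𝔸ˣ} (hG : AvgClosed d L G)
    (k : ℕ) (U : Site d → Fin d → 𝔸ˣ) (hU : ∀ x κ, U x κ ∈ G) {α : ℝ} (hα : 0 < α) (hα3 : C0 d * α ≤ 1 / 3)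
    (hα2 : 2 * α ≤ c2' d L) (lo hi : Site d) (hlohi : lo ≤ hi)
    (h32 : pdevOn (tlo L lo k) (thi L hi k) U < α * (((L : ℝ) ^ k)⁻¹) ^ 2)
    (V : Site d → Fin d → 𝔸ˣ) (hV : ∀ x μ, V x μ ∈ U1 𝔸) {δk : ℝ} (hδ : 0 ≤ δk)
    (hs : 2 * δk + 11 * (d : ℝ) ^ 2 * α ≤ 1 / 6)
    (h15 : ∀ n, n < k → ∀ z, tlo L lo n ≤ z → z ≤ thi L hi n → ∀ r : Fin d → Fin L,
      axialFn (avgIter L U (k - (n + 1))) ((L : ℤ) • z) ((L : ℤ) • z + boxVec L r) = 1)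
    (h33 : ∀ x ν, lo ≤ x → x + e ν ≤ hi → ‖((V x ν * (avgIter L U k x ν)⁻¹ : 𝔸ˣ) : 𝔸) - 1‖ < 2 * δk)
    (n : ℕ) (hn : n ≤ k) (x : Site d) (ν : Fin d) (hx : tlo L lo n ≤ x) (hxν : x + e ν ≤ thi L hi n) :
    ‖mlog (((pullIter L V n x ν * (avgIter L U (k - n) x ν)⁻¹ : 𝔸ˣ) : 𝔸))‖ ≤
        2 * (2 * δk + 8 * (d : ℝ) ^ 2 * α * ∑ m ∈ Finset.range n, (((L : ℝ) ^ m)⁻¹) ^ 2) ∧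
      2 * (2 * δk + 8 * (d : ℝ) ^ 2 * α * ∑ m ∈ Finset.range n, (((L : ℝ) ^ m)⁻¹) ^ 2) <
        4 * δk + 22 * (d : ℝ) ^ 2 * α := by
  have hL1 : 1 ≤ L := le_trans (by norm_num) hL
  obtain ⟨hW, h32'⟩ := clamp_regular hL1 hG.le_U1 hlohi hU h32
  have h33' : ∀ x ν, lo ≤ x → x + e ν ≤ hi →
      ‖((V x ν * (avgIter L (clampCfg (tlo L lo k) (thi L hi k) U) k x ν)⁻¹ : 𝔸ˣ) : 𝔸) - 1‖ < 2 * δk :=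
    fun x ν hx hxν => by
    rw [avgIter_clamp_eq' hL1 U (j := k) (m := 0) (by simp) (by simpa using hx) (by simpa using hxν)]
    exact h33 x ν hx hxν
  have h := argField36_lt L hL hd hG k _ hW hα hα3 hα2 h32' V hV hδ hs lo hi
    (fun n hn z hz hz' r => by rw [axialFn_clamp_eq' hL1 U hn hz hz' r]; exact h15 n hn z hz hz' r) h33' n hn x ν hx hxν
  rwa [avgIter_clamp_eq' hL1 U (show n + (k - n) = k by omega) hx hxν] at h

end PullBack

/-! ## §2 Two fine fields ([IV] p. 199), regularity of both on the finest cube only -/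

section TwoFields

variable {𝔸 : Type*} [NormedRing 𝔸] [NormOneClass 𝔸] [NormedAlgebra ℂ 𝔸] [CompleteSpace 𝔸]

/-- **`B15Layer199Lattice.norm_argField2_le`, LOCAL CARRIER** ((1.33)/(1.34) of [14] *"for p ∈ Ω_j"*): the two
plaquette bounds assumed on the unit plaquettes of the finest cube only; same conclusion `|(1/i)log[M^{k−n}(U)(b)
(M^{k−n}(U₀)(b))⁻¹]| ≤ 2(α₁ + 8d²α₀Σ) < 2α₁ + 22d²α₀` on the bonds of the depth-`n` cube (both orders) — equivalently
p26's `B8Ineq165Local.ineq165_local` followed by the logarithm. [cite: Balaban1989LargeFieldI, p.199 (after (1.96)); Balaban1985RegularSpaces, (1.65) p.87, (1.7) p.77] -/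
theorem norm_argField2_le_local (L : ℕ) (hL : 2 ≤ L) (hd : 1 ≤ d) {G : Subgroup 𝔸ˣ} (hG : AvgClosed d L G) (k : ℕ)
    (U₀ U : Site d → Fin d → 𝔸ˣ) (hU₀ : ∀ x κ, U₀ x κ ∈ G) (hU : ∀ x κ, U x κ ∈ G)
    {α₀ α₁ : ℝ} (hα : 0 < α₀) (hα3 : C0 d * α₀ ≤ 1 / 3) (hα2 : 2 * α₀ ≤ c2' d L)
    (lo hi : Site d) (hlohi : lo ≤ hi)
    (h33 : pdevOn (tlo L lo k) (thi L hi k) U₀ < α₀ * (((L : ℝ) ^ k)⁻¹) ^ 2)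
    (h34 : pdevOn (tlo L lo k) (thi L hi k) U < α₀ * (((L : ℝ) ^ k)⁻¹) ^ 2)
    (h19 : ∀ n, n < k → ∀ z, tlo L lo n ≤ z → z ≤ thi L hi n → ∀ r : Fin d → Fin L,
      axialFn (avgIter L U (k - (n + 1))) ((L : ℤ) • z) ((L : ℤ) • z + boxVec L r) =
        axialFn (avgIter L U₀ (k - (n + 1))) ((L : ℤ) • z) ((L : ℤ) • z + boxVec L r))
    (h35 : ∀ x ν, lo ≤ x → x + e ν ≤ hi →
      ‖((avgIter L U k x ν : 𝔸ˣ) : 𝔸) - avgIter L U₀ k x ν‖ ≤ α₁)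
    (hα₁ : 0 ≤ α₁) (hsmall : 11 * (d : ℝ) ^ 2 * α₀ + α₁ ≤ 1 / 6)
    (n : ℕ) (hn : n ≤ k) (x : Site d) (ν : Fin d) (hx : tlo L lo n ≤ x) (hxν : x + e ν ≤ thi L hi n) :
    ‖mlog (((avgIter L U (k - n) x ν * (avgIter L U₀ (k - n) x ν)⁻¹ : 𝔸ˣ) : 𝔸))‖ ≤
        2 * (α₁ + 8 * (d : ℝ) ^ 2 * α₀ * ∑ m ∈ Finset.range n, (((L : ℝ) ^ m)⁻¹) ^ 2) ∧
      ‖mlog (((avgIter L U₀ (k - n) x ν * (avgIter L U (k - n) x ν)⁻¹ : 𝔸ˣ) : 𝔸))‖ ≤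
        2 * (α₁ + 8 * (d : ℝ) ^ 2 * α₀ * ∑ m ∈ Finset.range n, (((L : ℝ) ^ m)⁻¹) ^ 2) ∧
      2 * (α₁ + 8 * (d : ℝ) ^ 2 * α₀ * ∑ m ∈ Finset.range n, (((L : ℝ) ^ m)⁻¹) ^ 2) <
        2 * α₁ + 22 * (d : ℝ) ^ 2 * α₀ := by
  have hL1 : 1 ≤ L := le_trans (by norm_num) hL
  obtain ⟨hW₀, h33'⟩ := clamp_regular hL1 hG.le_U1 hlohi hU₀ h33
  obtain ⟨hW, h34'⟩ := clamp_regular hL1 hG.le_U1 hlohi hU h34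
  have h35' : ∀ x ν, lo ≤ x → x + e ν ≤ hi →
      ‖((avgIter L (clampCfg (tlo L lo k) (thi L hi k) U) k x ν : 𝔸ˣ) : 𝔸) -
        avgIter L (clampCfg (tlo L lo k) (thi L hi k) U₀) k x ν‖ ≤ α₁ := fun x ν hx hxν => by
    rw [avgIter_clamp_eq' hL1 U (j := k) (m := 0) (by simp) (by simpa using hx) (by simpa using hxν),
      avgIter_clamp_eq' hL1 U₀ (j := k) (m := 0) (by simp) (by simpa using hx) (by simpa using hxν)]
    exact h35 x ν hx hxν
  have h := norm_argField2_le L hL hd hG k _ _ hW₀ hW hα hα3 hα2 h33' h34' lo hi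
    (fun n hn z hz hz' r => by
      rw [axialFn_clamp_eq' hL1 U hn hz hz' r, axialFn_clamp_eq' hL1 U₀ hn hz hz' r]
      exact h19 n hn z hz hz' r) h35' hα₁ hsmall n hn x ν hx hxν
  rwa [avgIter_clamp_eq' hL1 U (show n + (k - n) = k by omega) hx hxν,
    avgIter_clamp_eq' hL1 U₀ (show n + (k - n) = k by omega) hx hxν] at h

/-- **`B15Layer199Lattice.norm_argField2_le_orbit`, LOCAL CARRIER**: for EVERY `G`-valued pair with the two plaquette
bounds on the finest cube only, the gauge `u = twGauge L (π*U₀) (π*U) k y` of the clamped pair puts `U` itself in the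
axial gauge relative to `U₀` on the tower, and the bound holds for the pair `U^u, U₀` given the top closeness of that
pair. [cite: Balaban1989LargeFieldI, p.199 (after (1.96)); Balaban1985RegularSpaces, (1.19) p.79, (1.7) p.77] -/
theorem norm_argField2_le_orbit_local (L : ℕ) (hL : 2 ≤ L) (hd : 1 ≤ d) {G : Subgroup 𝔸ˣ} (hG : AvgClosed d L G)
    (k : ℕ) (U₀ U : Site d → Fin d → 𝔸ˣ) (hU₀ : ∀ x κ, U₀ x κ ∈ G) (hU : ∀ x κ, U x κ ∈ G)
    {α₀ α₁ : ℝ} (hα : 0 < α₀) (hα3 : C0 d * α₀ ≤ 1 / 3) (hα2 : 2 * α₀ ≤ c2' d L)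
    (y lo hi : Site d) (hlohi : lo ≤ hi)
    (h33 : pdevOn (tlo L lo k) (thi L hi k) U₀ < α₀ * (((L : ℝ) ^ k)⁻¹) ^ 2)
    (h34 : pdevOn (tlo L lo k) (thi L hi k) U < α₀ * (((L : ℝ) ^ k)⁻¹) ^ 2)
    (h35 : ∀ x ν, lo ≤ x → x + e ν ≤ hi →
      ‖((avgIter L (gaugeAct (twGauge L (clampCfg (tlo L lo k) (thi L hi k) U₀)
          (clampCfg (tlo L lo k) (thi L hi k) U) k y) U) k x ν : 𝔸ˣ) : 𝔸) - avgIter L U₀ k x ν‖ ≤ α₁)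
    (hα₁ : 0 ≤ α₁) (hsmall : 11 * (d : ℝ) ^ 2 * α₀ + α₁ ≤ 1 / 6)
    (n : ℕ) (hn : n ≤ k) (x : Site d) (ν : Fin d) (hx : tlo L lo n ≤ x) (hxν : x + e ν ≤ thi L hi n) :
    ‖mlog (((avgIter L (gaugeAct (twGauge L (clampCfg (tlo L lo k) (thi L hi k) U₀)
          (clampCfg (tlo L lo k) (thi L hi k) U) k y) U) (k - n) x ν *
        (avgIter L U₀ (k - n) x ν)⁻¹ : 𝔸ˣ) : 𝔸))‖ ≤
        2 * (α₁ + 8 * (d : ℝ) ^ 2 * α₀ * ∑ m ∈ Finset.range n, (((L : ℝ) ^ m)⁻¹) ^ 2) ∧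
      ‖mlog (((avgIter L U₀ (k - n) x ν *
        (avgIter L (gaugeAct (twGauge L (clampCfg (tlo L lo k) (thi L hi k) U₀)
          (clampCfg (tlo L lo k) (thi L hi k) U) k y) U) (k - n) x ν)⁻¹ : 𝔸ˣ) : 𝔸))‖ ≤
        2 * (α₁ + 8 * (d : ℝ) ^ 2 * α₀ * ∑ m ∈ Finset.range n, (((L : ℝ) ^ m)⁻¹) ^ 2) ∧
      2 * (α₁ + 8 * (d : ℝ) ^ 2 * α₀ * ∑ m ∈ Finset.range n, (((L : ℝ) ^ m)⁻¹) ^ 2) <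
        2 * α₁ + 22 * (d : ℝ) ^ 2 * α₀ := by
  have hL1 : 1 ≤ L := le_trans (by norm_num) hL
  obtain ⟨hW₀, h33'⟩ := clamp_regular hL1 hG.le_U1 hlohi hU₀ h33
  obtain ⟨hW, h34'⟩ := clamp_regular hL1 hG.le_U1 hlohi hU h34
  set W₀ := clampCfg (tlo L lo k) (thi L hi k) U₀ with hW₀def
  set W := clampCfg (tlo L lo k) (thi L hi k) U with hWdef
  set u := twGauge L W₀ W k y with hu
  have h35' : ∀ x ν, lo ≤ x → x + e ν ≤ hi →
      ‖((avgIter L (gaugeAct u W) k x ν : 𝔸ˣ) : 𝔸) - avgIter L W₀ k x ν‖ ≤ α₁ := fun x ν hx hxν => by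
    rw [avgIter_clamp_eq hL1 U u (j := k) (m := 0) (by simp) (by simpa using hx) (by simpa using hxν),
      avgIter_clamp_eq' hL1 U₀ (j := k) (m := 0) (by simp) (by simpa using hx) (by simpa using hxν)]
    exact h35 x ν hx hxν
  have h := norm_argField2_le_orbit L hL hd hG k W₀ W hW₀ hW hα hα3 hα2 h33' h34' y lo hi h35' hα₁ hsmall
    n hn x ν hx hxν
  rwa [avgIter_clamp_eq hL1 U u (show n + (k - n) = k by omega) hx hxν,
    avgIter_clamp_eq' hL1 U₀ (show n + (k - n) = k by omega) hx hxν] at h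

/-- **[IV] p. 199, the first member with the printed `max`, LOCAL CARRIER** — (1.96) *"for p ⊂ □^∼"* and (1.80) *"for
p ∈ Ω_k"* assumed on the plaquettes of the finest cube of the `h`-tower only: `|(1/i)log[M^{h−n}(U)(b)(M^{h−n}(U₀)(b))⁻¹]|
< 22d²max{1, X}ε_h + 2δ′_k` (both orders). [cite: Balaban1989LargeFieldI, p.199 (after (1.96)), (1.96) p.199, (1.80) p.195] -/
theorem layer199_lt_max_local (L : ℕ) (hL : 2 ≤ L) (hd : 1 ≤ d) {G : Subgroup 𝔸ˣ} (hG : AvgClosed d L G)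
    {h k : ℕ} (hhk : h ≤ k) (U₀ U : Site d → Fin d → 𝔸ˣ) (hU₀ : ∀ x κ, U₀ x κ ∈ G) (hU : ∀ x κ, U x κ ∈ G)
    {εh εk δk C β₀ X : ℝ} (hε : 0 < εh) (hC : 0 ≤ C) (hδ0 : 0 ≤ δk) (lo hi : Site d) (hlohi : lo ≤ hi)
    (h96 : pdevOn (tlo L lo h) (thi L hi h) U < 3 / 4 * εh * (((L : ℝ) ^ h)⁻¹) ^ 2)
    (h80 : pdevOn (tlo L lo h) (thi L hi h) U₀ < C * εk * (((L : ℝ) ^ k)⁻¹) ^ 2)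
    (hD : εk ≤ (1 + β₀) * Real.sqrt (k - h : ℕ) * εh)
    (hX : X = (((L : ℝ) ^ (k - h)) ^ 2)⁻¹ * Real.sqrt (k - h : ℕ) * C * (1 + β₀))
    (hs3 : C0 d * (max 1 X * εh) ≤ 1 / 3) (hs2 : 2 * (max 1 X * εh) ≤ c2' d L)
    (hs6 : 11 * (d : ℝ) ^ 2 * (max 1 X * εh) + δk ≤ 1 / 6)
    (h19 : ∀ n, n < h → ∀ z, tlo L lo n ≤ z → z ≤ thi L hi n → ∀ r : Fin d → Fin L,
      axialFn (avgIter L U (h - (n + 1))) ((L : ℤ) • z) ((L : ℤ) • z + boxVec L r) =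
        axialFn (avgIter L U₀ (h - (n + 1))) ((L : ℤ) • z) ((L : ℤ) • z + boxVec L r))
    (h82 : ∀ x ν, lo ≤ x → x + e ν ≤ hi →
      ‖((avgIter L U h x ν * (avgIter L U₀ h x ν)⁻¹ : 𝔸ˣ) : 𝔸) - 1‖ ≤ δk)
    (n : ℕ) (hn : n ≤ h) (x : Site d) (ν : Fin d) (hx : tlo L lo n ≤ x) (hxν : x + e ν ≤ thi L hi n) :
    ‖mlog (((avgIter L U (h - n) x ν * (avgIter L U₀ (h - n) x ν)⁻¹ : 𝔸ˣ) : 𝔸))‖ <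
        22 * (d : ℝ) ^ 2 * max 1 X * εh + 2 * δk ∧
      ‖mlog (((avgIter L U₀ (h - n) x ν * (avgIter L U (h - n) x ν)⁻¹ : 𝔸ˣ) : 𝔸))‖ <
        22 * (d : ℝ) ^ 2 * max 1 X * εh + 2 * δk := by
  have hL1 : 1 ≤ L := le_trans (by norm_num) hL
  obtain ⟨hW₀, h80'⟩ := clamp_regular hL1 hG.le_U1 hlohi hU₀ h80
  obtain ⟨hW, h96'⟩ := clamp_regular hL1 hG.le_U1 hlohi hU h96
  have h82' : ∀ x ν, lo ≤ x → x + e ν ≤ hi →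
      ‖((avgIter L (clampCfg (tlo L lo h) (thi L hi h) U) h x ν *
        (avgIter L (clampCfg (tlo L lo h) (thi L hi h) U₀) h x ν)⁻¹ : 𝔸ˣ) : 𝔸) - 1‖ ≤ δk := fun x ν hx hxν => by
    rw [avgIter_clamp_eq' hL1 U (j := h) (m := 0) (by simp) (by simpa using hx) (by simpa using hxν),
      avgIter_clamp_eq' hL1 U₀ (j := h) (m := 0) (by simp) (by simpa using hx) (by simpa using hxν)]
    exact h82 x ν hx hxν
  have hm := layer199_lt_max L hL hd hG hhk _ _ hW₀ hW hε hC hδ0 h96' h80' hD hX hs3 hs2 hs6 lo hi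
    (fun n hn z hz hz' r => by
      rw [axialFn_clamp_eq' hL1 U hn hz hz' r, axialFn_clamp_eq' hL1 U₀ hn hz hz' r]
      exact h19 n hn z hz hz' r) h82' n hn x ν hx hxν
  rwa [avgIter_clamp_eq' hL1 U (show n + (h - n) = h by omega) hx hxν,
    avgIter_clamp_eq' hL1 U₀ (show n + (h - n) = h by omega) hx hxν] at hm

/-- **[IV] p. 199, the whole chain `< 23d²ε_h`, LOCAL CARRIER** — (1.96)/(1.80) on the plaquettes of the finest cube
only; `X ≤ 1`, `δ′_k ≤ (1+β₀)N^{1/2}rε_h`, `2(1+β₀)N^{1/2}r < d²` as in `B15Layer199Lattice.layer199_lt` (r12's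
`B15Bounds199.chainA_le`/`chainA_lt`). [cite: Balaban1989LargeFieldI, p.199 (after (1.96))] -/
theorem layer199_lt_local (L : ℕ) (hL : 2 ≤ L) (hd : 1 ≤ d) {G : Subgroup 𝔸ˣ} (hG : AvgClosed d L G)
    {h k : ℕ} (hhk : h ≤ k) (U₀ U : Site d → Fin d → 𝔸ˣ) (hU₀ : ∀ x κ, U₀ x κ ∈ G) (hU : ∀ x κ, U x κ ∈ G)
    {εh εk δk C β₀ X r : ℝ} (hε : 0 < εh) (hC : 0 ≤ C) (hδ0 : 0 ≤ δk) (lo hi : Site d) (hlohi : lo ≤ hi)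
    (h96 : pdevOn (tlo L lo h) (thi L hi h) U < 3 / 4 * εh * (((L : ℝ) ^ h)⁻¹) ^ 2)
    (h80 : pdevOn (tlo L lo h) (thi L hi h) U₀ < C * εk * (((L : ℝ) ^ k)⁻¹) ^ 2)
    (hD : εk ≤ (1 + β₀) * Real.sqrt (k - h : ℕ) * εh)
    (hX : X = (((L : ℝ) ^ (k - h)) ^ 2)⁻¹ * Real.sqrt (k - h : ℕ) * C * (1 + β₀)) (hX1 : X ≤ 1)
    (hδ : δk ≤ (1 + β₀) * Real.sqrt (k - h : ℕ) * r * εh)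
    (hsmall : 2 * (1 + β₀) * Real.sqrt (k - h : ℕ) * r < (d : ℝ) ^ 2)
    (hs3 : C0 d * εh ≤ 1 / 3) (hs2 : 2 * εh ≤ c2' d L) (hs6 : 11 * (d : ℝ) ^ 2 * εh + δk ≤ 1 / 6)
    (h19 : ∀ n, n < h → ∀ z, tlo L lo n ≤ z → z ≤ thi L hi n → ∀ r : Fin d → Fin L,
      axialFn (avgIter L U (h - (n + 1))) ((L : ℤ) • z) ((L : ℤ) • z + boxVec L r) =
        axialFn (avgIter L U₀ (h - (n + 1))) ((L : ℤ) • z) ((L : ℤ) • z + boxVec L r))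
    (h82 : ∀ x ν, lo ≤ x → x + e ν ≤ hi →
      ‖((avgIter L U h x ν * (avgIter L U₀ h x ν)⁻¹ : 𝔸ˣ) : 𝔸) - 1‖ ≤ δk)
    (n : ℕ) (hn : n ≤ h) (x : Site d) (ν : Fin d) (hx : tlo L lo n ≤ x) (hxν : x + e ν ≤ thi L hi n) :
    ‖mlog (((avgIter L U (h - n) x ν * (avgIter L U₀ (h - n) x ν)⁻¹ : 𝔸ˣ) : 𝔸))‖ < 23 * (d : ℝ) ^ 2 * εh ∧
      ‖mlog (((avgIter L U₀ (h - n) x ν * (avgIter L U (h - n) x ν)⁻¹ : 𝔸ˣ) : 𝔸))‖ < 23 * (d : ℝ) ^ 2 * εh := by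
  have hm : max 1 X = 1 := max_eq_left hX1
  have hs3' : C0 d * (max 1 X * εh) ≤ 1 / 3 := by rw [hm, one_mul]; exact hs3
  have hs2' : 2 * (max 1 X * εh) ≤ c2' d L := by rw [hm, one_mul]; exact hs2
  have hs6' : 11 * (d : ℝ) ^ 2 * (max 1 X * εh) + δk ≤ 1 / 6 := by rw [hm, one_mul]; exact hs6
  obtain ⟨h1, h2⟩ := layer199_lt_max_local L hL hd hG hhk U₀ U hU₀ hU hε hC hδ0 lo hi hlohi h96 h80 hD hX hs3' hs2'
    hs6' h19 h82 n hn x ν hx hxν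
  have hA := B15Bounds199.chainA_le (d := (d : ℝ)) (εh := εh) hX1 hδ
  have hB := B15Bounds199.chainA_lt (εh := εh) hsmall hε
  exact ⟨by linarith, by linarith⟩

end TwoFields

end Literature.MathematicalPhysics.QuantumFieldTheory.Balaban1983to89.B15LayerLocal
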